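import Summits.NavierStokesRegularity.NavierStokesRegularity.Theorems.FilamentSkeletonRssCoreLinearInvertibilityOddAttenuationWirtinger
import Summits.NavierStokesRegularity.NavierStokesRegularity.Theorems.FilamentSkeletonRssCoreLinearInvertibilityOddAttenuationConj

/-!
# Stub `stub_oddAttenuation` of crux `CoreLinearInvertibility` (stmt-NavierStokesRegularity-17973),
# line `Sketch`: high-rotation attenuation of the local operator on odd functions

For `λ ∈ (0,1)` and every `ε > 0` there is `R₀` such that for `R ≥ R₀` and every odd `C²` function
`v` of Gaussian class (with gradient and Hessian), `‖v‖_{X_λ} ≤ ε ‖L_λ v − R v^G·∇v‖_{X_λ}`.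

Proof (elementary, all constants depend on `λ, ε` only). Conjugate by `p = e^{(1−λ)|x|²/8}`
(`G_λ⁻¹ = (4π/(1−λ))p²`, tools H): for `ũ = p v`, `p·(L_λ v − RΩ∂_θv) = H̃ũ` with
`H̃ũ = Δũ + λx₀∂₀ũ − (κ|x|² + δx₀²)ũ + ((1+λ)/2)ũ − RΩ∂_θũ`, `κ = (1−λ)²/16 > 0`, `δ = λ(1−λ)/4 ≥ 0`,
and the claim is `∫ũ² ≤ ε² ∫(H̃ũ)²` in flat `L²`. With `n = ∫ũ²`, `q = ∫(H̃ũ)²`, `X = ∫|x|²ũ²`,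
`W = ∫|x|²|∇ũ|²`, `Θ = ∫Ω(∂_θũ)²` the energy, weighted, rotation and two-zone estimates (tools D–G)

  `κX ≤ √q√n + n/2`,  `W ≤ q/(4κ) + 2n + X/2`,  `RΘ ≤ √q√W + λW + δX`,  `n ≤ 2π(4+ρ²)Θ + X/ρ²`

(the last one for odd `ũ`, from Wirtinger on circles) combine, with `ρ² = 2A`, `A = κ⁻¹(ε⁻¹ + ½)`,
`D = (4κε²)⁻¹ + 2 + A/2`, `E = √D/ε + λD + δA`, `M = 4π(4+2A)`, into `n ≤ ε²q` as soon as
`R ≥ R₀ = ME + 1` (`oddAttenuation_real_algebra`: if `n > ε²q` then `X ≤ An`, `W ≤ Dn`, `RΘ ≤ En`,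
`n ≤ MΘ`, so `(ME+1)Θ ≤ RΘ ≤ En ≤ EMΘ`, forcing `Θ = 0 = n`).
-/

set_option linter.dupNamespace false

noncomputable section

namespace Summit.NavierStokesRegularity.NavierStokesRegularity.Theorems

open MeasureTheory Filter Topology Set
open Literature.Analysis.FluidPDE
open Summit.AnomalousDissipation.AnomalousDissipation.Theorems.MarginalStabilityChainStretchedVortexRows
open scoped InnerProductSpace Laplacian ContDiff

/-! ### The conjugated operator preserves continuity and the decay class -/

section ConjOp

variable {u : EuclideanSpace ℝ (Fin 2) → ℝ} (hu : ContDiff ℝ 2 u)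
  (hB : ∃ (C : ℝ) (N : ℕ), ∀ x, |u x| ≤ C * (1 + ‖x‖) ^ N * Real.exp (-(1 / 8 * ‖x‖ ^ 2)) ∧
      ‖fderiv ℝ u x‖ ≤ C * (1 + ‖x‖) ^ N * Real.exp (-(1 / 8 * ‖x‖ ^ 2)) ∧
      ‖fderiv ℝ (fderiv ℝ u) x‖ ≤ C * (1 + ‖x‖) ^ N * Real.exp (-(1 / 8 * ‖x‖ ^ 2)))
  (lam κ δ R : ℝ)

include hu in
/-- `H̃u` is continuous. [folklore] -/
theorem continuous_conjOp : Continuous fun x => Δ u x + lam * x 0 * fderiv ℝ u x (EuclideanSpace.single 0 1) -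
    (κ * ‖x‖ ^ 2 + δ * x 0 ^ 2) * u x + (1 + lam) / 2 * u x -
    R * ((8 * Real.pi)⁻¹ * burgersPhi (‖x‖ ^ 2 / 4) * fderiv ℝ u x (perp x)) :=
  ((((continuous_laplacian hu).add ((continuous_const.mul (contDiff_coord 0 (n := 0)).continuous).mul
    (continuous_fderiv_apply_of_contDiff_two hu _))).sub
    ((contDiff_confiningPotential κ δ (n := 0)).continuous.mul hu.continuous)).add
    (continuous_const.mul hu.continuous)).sub
    (continuous_const.mul ((contDiff_omega (n := 0)).continuous.mul (continuous_fderiv_perp_of_contDiff_two hu)))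

include hu hB in
/-- `H̃u` has Gaussian decay `1/8`. [folklore] -/
theorem gaussDecay_conjOp : ∃ (C : ℝ) (N : ℕ), ∀ x : EuclideanSpace ℝ (Fin 2),
    |Δ u x + lam * x 0 * fderiv ℝ u x (EuclideanSpace.single 0 1) -
      (κ * ‖x‖ ^ 2 + δ * x 0 ^ 2) * u x + (1 + lam) / 2 * u x -
      R * ((8 * Real.pi)⁻¹ * burgersPhi (‖x‖ ^ 2 / 4) * fderiv ℝ u x (perp x))| ≤
      C * (1 + ‖x‖) ^ N * Real.exp (-(1 / 8 * ‖x‖ ^ 2)) := by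
  have hU := gaussDecay_self hB
  have hlap : ∀ x, Δ u x = fderiv ℝ (fderiv ℝ u) x (EuclideanSpace.single 0 1) (EuclideanSpace.single 0 1) +
      fderiv ℝ (fderiv ℝ u) x (EuclideanSpace.single 1 1) (EuclideanSpace.single 1 1) := fun x => by
    rw [laplacian_eq_sum_fderiv_fderiv (EuclideanSpace.basisFun (Fin 2) ℝ) hu x, Fin.sum_univ_two,
      EuclideanSpace.basisFun_apply, EuclideanSpace.basisFun_apply, fderiv_partialDeriv_apply hu,
      fderiv_partialDeriv_apply hu]
  have hΔ : ∃ (C : ℝ) (N : ℕ), ∀ x : EuclideanSpace ℝ (Fin 2), |Δ u x| ≤ C * (1 + ‖x‖) ^ N * Real.exp (-(1 / 8 * ‖x‖ ^ 2)) :=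
    gaussDecay_of_le_add (gaussDecay_fderiv_fderiv_apply hB _ _) (gaussDecay_fderiv_fderiv_apply hB _ _)
      fun x => by rw [hlap]; exact abs_add_le _ _
  have h2 := gaussDecay_of_le_poly_mul (polyBound_of_le_mul (polyBound_const lam) (polyBound_coord 0)
    (H := fun x => lam * x 0) fun x => (abs_mul _ _).le) (gaussDecay_fderiv_apply hB (EuclideanSpace.single 0 1))
    (H := fun x => lam * x 0 * fderiv ℝ u x (EuclideanSpace.single 0 1)) fun x => (abs_mul _ _).le
  have h3 := gaussDecay_of_le_poly_mul (polyBound_confiningPotential κ δ) hU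
    (H := fun x => (κ * ‖x‖ ^ 2 + δ * x 0 ^ 2) * u x) fun x => (abs_mul _ _).le
  have h4 := gaussDecay_of_le_poly_mul (polyBound_const ((1 + lam) / 2)) hU
    (H := fun x => (1 + lam) / 2 * u x) fun x => (abs_mul _ _).le
  have h5 := gaussDecay_of_le_poly_mul (polyBound_of_le_mul (polyBound_const R) polyBound_omega
    (H := fun x => R * ((8 * Real.pi)⁻¹ * burgersPhi (‖x‖ ^ 2 / 4))) fun x => (abs_mul _ _).le)
    (gaussDecay_fderiv_perp hB)
    (H := fun x => R * ((8 * Real.pi)⁻¹ * burgersPhi (‖x‖ ^ 2 / 4) * fderiv ℝ u x (perp x)))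
    fun x => le_of_eq (by rw [← abs_mul]; ring_nf)
  exact gaussDecay_of_le_add (gaussDecay_of_le_add (gaussDecay_of_le_add (gaussDecay_of_le_add hΔ h2
    fun x => abs_add_le _ _) h3 fun x => abs_sub _ _) h4 fun x => abs_add_le _ _) h5 fun x => abs_sub _ _

end ConjOp

/-! ### The real-variable endgame -/

/-- **The endgame in real numbers.** If `n, q, X, W, Θ ≥ 0` satisfy the energy, weighted, rotation and
two-zone inequalities with `R ≥ ME + 1`, then `n ≤ ε² q`. [folklore] -/
theorem oddAttenuation_real_algebra {ε κ lam δ A D E M n q X W Θ R : ℝ}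
    (hε : 0 < ε) (hκ : 0 < κ) (hlam : 0 ≤ lam) (hδ : 0 ≤ δ)
    (hA : A = κ⁻¹ * (ε⁻¹ + 1 / 2)) (hD : D = (4 * κ * ε ^ 2)⁻¹ + 2 + A / 2)
    (hE : E = Real.sqrt D / ε + lam * D + δ * A) (hM : M = 4 * Real.pi * (4 + 2 * A))
    (hn : 0 ≤ n) (hq : 0 ≤ q) (hΘ : 0 ≤ Θ)
    (h1 : κ * X ≤ Real.sqrt q * Real.sqrt n + 1 / 2 * n)
    (h2 : W ≤ q / (4 * κ) + 2 * n + 1 / 2 * X)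
    (h3 : R * Θ ≤ Real.sqrt q * Real.sqrt W + lam * W + δ * X)
    (h4 : n ≤ 2 * Real.pi * (4 + 2 * A) * Θ + (2 * A)⁻¹ * X)
    (hR : M * E + 1 ≤ R) : n ≤ ε ^ 2 * q := by
  by_contra hcon
  rw [not_le] at hcon
  have hn0 : 0 < n := lt_of_le_of_lt (by positivity) hcon
  have hA0 : 0 < A := by rw [hA]; positivity
  have hqn : q ≤ n / ε ^ 2 := by rw [le_div_iff₀ (by positivity)]; nlinarith
  have hsq : Real.sqrt q ≤ Real.sqrt n / ε :=
    calc Real.sqrt q ≤ Real.sqrt (n / ε ^ 2) := Real.sqrt_le_sqrt hqn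
      _ = Real.sqrt n / ε := by rw [Real.sqrt_div' n (sq_nonneg ε), Real.sqrt_sq hε.le]
  have hnn : Real.sqrt n * Real.sqrt n = n := Real.mul_self_sqrt hn
  have hsn := Real.sqrt_nonneg n
  -- `X ≤ A n`
  have hX1 : X ≤ A * n := by
    have h : κ * X ≤ (ε⁻¹ + 1 / 2) * n :=
      calc κ * X ≤ Real.sqrt q * Real.sqrt n + 1 / 2 * n := h1
        _ ≤ Real.sqrt n / ε * Real.sqrt n + 1 / 2 * n := by gcongr
        _ = (ε⁻¹ + 1 / 2) * n := by rw [div_mul_eq_mul_div, hnn]; ring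
    calc X = κ⁻¹ * (κ * X) := by field_simp
      _ ≤ κ⁻¹ * ((ε⁻¹ + 1 / 2) * n) := by gcongr
      _ = A * n := by rw [hA, mul_assoc]
  -- `W ≤ D n`
  have hW1 : W ≤ D * n := by
    calc W ≤ q / (4 * κ) + 2 * n + 1 / 2 * X := h2
      _ ≤ (n / ε ^ 2) / (4 * κ) + 2 * n + 1 / 2 * (A * n) := by gcongr
      _ = D * n := by rw [hD]; field_simp
  -- `R Θ ≤ E n`
  have hD0 : 0 ≤ D := by rw [hD]; positivity
  have hW2 : Real.sqrt W ≤ Real.sqrt D * Real.sqrt n := by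
    rw [← Real.sqrt_mul hD0]; exact Real.sqrt_le_sqrt hW1
  have hsq0 : 0 ≤ Real.sqrt n / ε := by positivity
  have hΘ1 : R * Θ ≤ E * n :=
    calc R * Θ ≤ Real.sqrt q * Real.sqrt W + lam * W + δ * X := h3
      _ ≤ Real.sqrt n / ε * (Real.sqrt D * Real.sqrt n) + lam * (D * n) + δ * (A * n) := by
          gcongr
      _ = (Real.sqrt D / ε + lam * D + δ * A) * n := by
          rw [show Real.sqrt n / ε * (Real.sqrt D * Real.sqrt n) =
            Real.sqrt D / ε * (Real.sqrt n * Real.sqrt n) by ring, hnn]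
          ring
      _ = E * n := by rw [hE]
  -- `n ≤ M Θ`
  have hn1 : n ≤ M * Θ := by
    have h : (2 * A)⁻¹ * X ≤ n / 2 :=
      calc (2 * A)⁻¹ * X ≤ (2 * A)⁻¹ * (A * n) := by gcongr
        _ = n / 2 := by field_simp
    have h' : n ≤ 2 * Real.pi * (4 + 2 * A) * Θ + n / 2 := h4.trans (by linarith)
    rw [hM]
    linarith
  -- contradiction
  have hE0 : 0 ≤ E := by rw [hE]; positivity
  have h5 : (M * E + 1) * Θ ≤ R * Θ := mul_le_mul_of_nonneg_right hR hΘ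
  have h6 : E * n ≤ E * (M * Θ) := mul_le_mul_of_nonneg_left hn1 hE0
  have hΘ0 : Θ ≤ 0 := by nlinarith
  have hMΘ : M * Θ ≤ 0 := by
    have hM0 : 0 < M := by rw [hM]; positivity
    nlinarith
  linarith

/-! ### The registered stub -/

/-- **Stub 6c (high-rotation attenuation of the LOCAL operator on odd functions).** For `λ ∈ (0,1)`
and every `ε > 0` there is `R₀` such that for `R ≥ R₀` and every odd `C²` function `v` of Gaussian
class (with its gradient and Hessian), `‖v‖_{X_λ} ≤ ε ‖L_λ v − R v^G·∇v‖_{X_λ}`. Registered stub of crux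
stmt-NavierStokesRegularity-17973, line `Sketch`; proof by ground-state conjugation, the energy /
weighted / angular-momentum identities and Wirtinger on circles (module docstring). [folklore] -/
theorem stub_oddAttenuation :
    ∀ lam ∈ Set.Ioo (0 : ℝ) 1, ∀ ε : ℝ, 0 < ε → ∃ R₀ : ℝ, ∀ R : ℝ, R₀ ≤ R →
    ∀ v : EuclideanSpace ℝ (Fin 2) → ℝ, ContDiff ℝ 2 v → (∀ x, v (-x) = -v x) →
    (∃ (C : ℝ) (N : ℕ), ∀ x : EuclideanSpace ℝ (Fin 2),
      |v x| ≤ C * (1 + ‖x‖) ^ N * Real.exp (-(‖x‖ ^ 2 / 4)) ∧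
      ‖fderiv ℝ v x‖ ≤ C * (1 + ‖x‖) ^ N * Real.exp (-(‖x‖ ^ 2 / 4)) ∧
      ‖fderiv ℝ (fderiv ℝ v) x‖ ≤ C * (1 + ‖x‖) ^ N * Real.exp (-(‖x‖ ^ 2 / 4))) →
    ∫ x, (gaussWeightLam lam x)⁻¹ * v x ^ 2 ≤
      ε ^ 2 * ∫ x, (gaussWeightLam lam x)⁻¹ * (strainedVorticityOperator lam v x -
        R * ⟪gaussVortexVelocity x, gradient v x⟫_ℝ) ^ 2 := by
  intro lam hlam ε hε
  obtain ⟨hl0, hl1⟩ := hlam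
  -- the constants
  set κ : ℝ := (1 - lam) ^ 2 / 16 with hκ
  set δ : ℝ := lam * (1 - lam) / 4 with hδ
  have h1l : 0 < 1 - lam := by linarith
  have hκ0 : 0 < κ := by rw [hκ]; exact div_pos (pow_pos h1l 2) (by norm_num)
  have hδ0 : 0 ≤ δ := by rw [hδ]; exact div_nonneg (mul_nonneg hl0.le h1l.le) (by norm_num)
  set A : ℝ := κ⁻¹ * (ε⁻¹ + 1 / 2) with hA
  set D : ℝ := (4 * κ * ε ^ 2)⁻¹ + 2 + A / 2 with hD
  set E : ℝ := Real.sqrt D / ε + lam * D + δ * A with hE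
  set M : ℝ := 4 * Real.pi * (4 + 2 * A) with hM
  have hA0 : 0 < A := by rw [hA]; positivity
  refine ⟨M * E + 1, fun R hR v hv hodd hvB => ?_⟩
  -- the conjugated function `ũ = p v` and the conjugated operator `f = H̃ũ`
  set ut : EuclideanSpace ℝ (Fin 2) → ℝ := fun y => Real.exp ((1 - lam) / 8 * ‖y‖ ^ 2) * v y with hut
  have hu : ContDiff ℝ 2 ut := contDiff_conj hv lam
  have huodd : ∀ x, ut (-x) = -ut x := fun x => conj_odd lam hodd x
  have hB : ∃ (C : ℝ) (N : ℕ), ∀ x, |ut x| ≤ C * (1 + ‖x‖) ^ N * Real.exp (-(1 / 8 * ‖x‖ ^ 2)) ∧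
      ‖fderiv ℝ ut x‖ ≤ C * (1 + ‖x‖) ^ N * Real.exp (-(1 / 8 * ‖x‖ ^ 2)) ∧
      ‖fderiv ℝ (fderiv ℝ ut) x‖ ≤ C * (1 + ‖x‖) ^ N * Real.exp (-(1 / 8 * ‖x‖ ^ 2)) :=
    conj_gaussDecay hv lam hl0.le hl1.le hvB
  set f : EuclideanSpace ℝ (Fin 2) → ℝ := fun x => Δ ut x + lam * x 0 * fderiv ℝ ut x (EuclideanSpace.single 0 1) -
    (κ * ‖x‖ ^ 2 + δ * x 0 ^ 2) * ut x + (1 + lam) / 2 * ut x -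
    R * ((8 * Real.pi)⁻¹ * burgersPhi (‖x‖ ^ 2 / 4) * fderiv ℝ ut x (perp x)) with hfdef
  have hf : ∀ x, f x = Δ ut x + lam * x 0 * fderiv ℝ ut x (EuclideanSpace.single 0 1) -
      (κ * ‖x‖ ^ 2 + δ * x 0 ^ 2) * ut x + (1 + lam) / 2 * ut x -
      R * ((8 * Real.pi)⁻¹ * burgersPhi (‖x‖ ^ 2 / 4) * fderiv ℝ ut x (perp x)) := fun x => rfl
  have hfc : Continuous f := continuous_conjOp hu lam κ δ R
  have hfB : ∃ (C : ℝ) (N : ℕ), ∀ x, |f x| ≤ C * (1 + ‖x‖) ^ N * Real.exp (-(1 / 8 * ‖x‖ ^ 2)) :=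
    gaussDecay_conjOp hu hB lam κ δ R
  -- the four estimates
  have h1 := oddAttenuation_energy_estimate hu hB hf hfc hfB hδ0
  have h2 := oddAttenuation_weighted_estimate hu hB hf hfc hfB hκ0 hl0.le hδ0
  have h3 := oddAttenuation_rotation_estimate hu hB hf hfc hfB hl0.le hδ0
  have hρ : 0 < Real.sqrt (2 * A) := Real.sqrt_pos.2 (by positivity)
  have h4 := oddAttenuation_twoZone_estimate hu hB huodd hρ
  rw [Real.sq_sqrt (by positivity)] at h4
  -- nonnegativity of the flat norms
  have hn : 0 ≤ ∫ x, ut x ^ 2 := integral_nonneg fun x => sq_nonneg _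
  have hq : 0 ≤ ∫ x, f x ^ 2 := integral_nonneg fun x => sq_nonneg _
  have hΘ : 0 ≤ ∫ x, (8 * Real.pi)⁻¹ * burgersPhi (‖x‖ ^ 2 / 4) * fderiv ℝ ut x (perp x) ^ 2 :=
    integral_nonneg fun x => mul_nonneg (mul_pos (by positivity) (burgersPhi_pos _)).le (sq_nonneg _)
  -- the endgame
  have key := oddAttenuation_real_algebra hε hκ0 hl0.le hδ0 hA hD hE hM hn hq hΘ h1 h2 h3 h4 hR
  -- back to `X_λ`
  have hc : 0 < 4 * Real.pi / (1 - lam) := div_pos (by positivity) h1l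
  have eL : ∫ x, (gaussWeightLam lam x)⁻¹ * v x ^ 2 = 4 * Real.pi / (1 - lam) * ∫ x, ut x ^ 2 :=
    integral_inv_gaussWeightLam_mul_sq_eq lam v
  have hpf : ∀ x, Real.exp ((1 - lam) / 8 * ‖x‖ ^ 2) *
      (strainedVorticityOperator lam v x - R * ⟪gaussVortexVelocity x, gradient v x⟫_ℝ) = f x := fun x =>
    expWeight_mul_localOp_eq hv lam R x
  have eR : ∫ x, (gaussWeightLam lam x)⁻¹ * (strainedVorticityOperator lam v x -
      R * ⟪gaussVortexVelocity x, gradient v x⟫_ℝ) ^ 2 = 4 * Real.pi / (1 - lam) * ∫ x, f x ^ 2 := by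
    rw [integral_inv_gaussWeightLam_mul_sq_eq lam]
    congr 1
    exact integral_congr_ae (Eventually.of_forall fun x => by simp only [hpf x])
  rw [eL, eR]
  calc 4 * Real.pi / (1 - lam) * ∫ x, ut x ^ 2 ≤ 4 * Real.pi / (1 - lam) * (ε ^ 2 * ∫ x, f x ^ 2) :=
        mul_le_mul_of_nonneg_left key hc.le
    _ = ε ^ 2 * (4 * Real.pi / (1 - lam) * ∫ x, f x ^ 2) := by ring

end Summit.NavierStokesRegularity.NavierStokesRegularity.Theorems
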